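import Literature.NumberTheory.DiophantineGeometry.PastenThm164FromShimuraEngineProofs
import Literature.NumberTheory.Automorphic.ShimuraCurveRibetTakahashiDenominatorAwayFromS
import Literature.NumberTheory.EllipticCurves.PastenValuationProductSemistableProofs
import Literature.NumberTheory.Automorphic.ShimuraCurveRibetTakahashiPeterssonProofs
import HarnessLib

/-!
# Pasten's Theorem 16.1 from the Shimura-curve engine: `pastenShimura2024_thm_16_1` (hence
# Cor. 16.2, Thm. 1.15, Thm. 1.12) is a theorem over the named facts of
# `ShimuraCurveRibetTakahashi.lean`, Theorem 6.1 (a) and Theorem 14.1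

Topic `Literature/NumberTheory/DiophantineGeometry`; a proofs-only companion (theorems only: no
definitions, no named facts, D-0026) of `PastenValuationProductsAdmissible.lean`, the twin of
`PastenThm164FromShimuraEngineProofs.lean` for the general estimate: H. Pasten, *Shimura curves and
the abc conjecture*, J. Number Theory 254 (2024) = arXiv:1705.09251v4 [`PastenShimura2024`],
**Theorem 16.1** p. 49 — for `S` finite and `ε > 0`, every `E/ℚ` semi-stable away from `S` of
conductor `N ≫_{ε,S} 1` and every admissible `N = DM` satisfy `∏_{p∣D} v_p(Δ_E) < N^{11/3+ε}` — the
tree's named fact `pastenShimura2024_thm_16_1`, from which Cor. 16.2 (`pasten_cor_16_2`), Thm. 1.15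
(`pasten_thm_1_15`) and, with Mestre–Oesterlé, Thm. 1.12 (`pasten_valuationProduct_semistable`:
`∏_{p∣N} v_p(Δ_E) ≪_ε N^{11/2+ε}` for all semi-stable `E`, the unconditional rung under the cruxes of
route `RibetTakahashiSplit`) already hang BY NAME. Inputs (the printed proof's, p. 49):

* `hJL : nonempty_shimuraParametrizationData`, `hFrey : normSq_form_eq_deg_mul_covolume`,
  `hopt : exists_optimal_modularParametrizationData` (⟺ Modularity),
  `hht : abs_neronLatticeHeight_sub_le_of_isIsogenous`, `h141 : PastenShimura2024_thm_14_1_fDM` —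
  as for Thm. 16.4;
* `h61a : PastenShimura2024_thm_6_1_a` — Thm. 6.1 **(a)** (denominator `≤ κ_S^{ω(D)} D`, typed by
  this seat in `Automorphic/ShimuraCurveRibetTakahashiDenominatorAwayFromS.lean`) in place of (b):
  (EqUsingRT) p. 49 carries the extra `+ log D`;
* `hManin : PastenShimura2024_cor_10_2` at the given `S` ("by Corollary 10.2 we see that
  `log |c_f| ≪_S 1`", p. 49);
* `hPet` — the Petersson bound for the newform of EVERY elliptic curve over `ℚ` in Mai–Murty's
  printed form `Re (f,f) ≤ C · N · (log N)³` (the conclusion of the tree's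
  `peterssonProduct_re_le_log_pow_three_of_murty` / `…_of_symmSq_upper_bound`,
  `ShimuraCurveRibetTakahashiPeterssonProofs.lean`): beyond the printed class of Thm. 16.4 the tree
  proves this only at levels `2ᵗM`, `t ≤ 7`, `M` odd squarefree, so for general `S` it is an INPUT —
  given either by the named fact `murty_petersson_newform_upper_bound`
  (`pastenShimura2024_thm_16_1_of_engine_of_murty`) or by its symmetric-square input.

Proof: that of `pastenShimura2024_thm_16_4_of_engine` (see that file's docstring) with `b ≤ κ^ω D`
for `b ≤ κ^ω`, whence one extra factor `D`; `D · M = N` turns `N^{8/3+ε/2} M · D` into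
`N^{11/3+ε/2}`, and `(log N)³ ≤ 27 N^η/η³` replaces the squared bound. The real-number lemmas are
private copies of that file's (Literature files do not share private lemmas).

## Main statements

* `pastenShimura2024_thm_16_1_of_engine (hJL) (hFrey) (h61a) (hopt) (hManin) (hht) (h141) (hPet) :
  pastenShimura2024_thm_16_1`; `…_of_murty` (the Petersson input by name);
* by name over the same inputs: `pasten_cor_16_2_of_engine` (Cor. 16.2), `pasten_thm_1_15_of_engine`
  (Thm. 1.15, Tamagawa), `pasten_valuationProduct_semistable_of_engine` (Thm. 1.12, with
  `mestreOesterle_factorization_le_five`), `pasten_thm_1_12_strict_of_engine` (Thm. 1.12 / 16.5 both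
  displays, with Thm. 6.1 (b) as well).

## References

* [PastenShimura2024] H. Pasten, J. Number Theory 254 (2024) = arXiv:1705.09251v4: Thm. 6.1 (a)
  p. 20, Cor. 5.3 p. 17, Cor. 10.2 p. 33, Thm. 14.1 p. 44, Thm. 16.1 with its proof p. 49, Cor. 16.2,
  Cor. 16.3, Thm. 16.5 p. 50.
* [MaiMurty1994] L. Mai, M. R. Murty, Contemp. Math. 166, §2 (`(f,f) ≪ N (log N)³`).
-/

noncomputable section

open Finset
open scoped MatrixGroups

namespace Literature.NumberTheory.DiophantineGeometry

open Literature.NumberTheory.Automorphic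
open Literature.NumberTheory.EllipticCurves.ModularForms
open CongruenceSubgroup

/-! ### Elementary bookkeeping (private copies of `PastenThm164FromShimuraEngineProofs`) -/

/-- `2^{ω(n)} ≤ d(n)`. [folklore] -/
private theorem two_pow_card_primeFactors_le_card_divisors {n : ℕ} (hn : n ≠ 0) :
    2 ^ n.primeFactors.card ≤ n.divisors.card := by
  rw [Nat.card_divisors hn]
  calc 2 ^ n.primeFactors.card = ∏ _p ∈ n.primeFactors, 2 := by simp
    _ ≤ ∏ p ∈ n.primeFactors, (n.factorization p + 1) := by
        apply Finset.prod_le_prod (fun _ _ => by norm_num)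
        intro p hp
        have : 0 < n.factorization p :=
          (Nat.prime_of_mem_primeFactors hp).factorization_pos_of_dvd hn
            (Nat.dvd_of_mem_primeFactors hp)
        omega

/-- `κ^{ω(D)} ≤ C^κ N^θ` from the divisor bound `d(D) ≤ C D^{θ/κ}`, `D ≤ N`. [folklore] -/
private theorem kappa_pow_le {κ D N : ℕ} {C θ : ℝ} (hκ : 1 ≤ κ) (hD : D ≠ 0) (hDN : D ≤ N)
    (hC : 1 ≤ C) (hθ : 0 < θ) (hdiv : (D.divisors.card : ℝ) ≤ C * (D : ℝ) ^ (θ / κ)) :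
    (κ : ℝ) ^ D.primeFactors.card ≤ C ^ κ * (N : ℝ) ^ θ := by
  set ω := D.primeFactors.card
  have h2ω : (2 : ℝ) ^ ω ≤ D.divisors.card := by
    exact_mod_cast two_pow_card_primeFactors_le_card_divisors hD
  have hκ2 : (κ : ℝ) ≤ 2 ^ κ := by exact_mod_cast (Nat.lt_two_pow_self (n := κ)).le
  have hDθ : (D : ℝ) ^ (θ / κ) ≤ (N : ℝ) ^ (θ / κ) :=
    Real.rpow_le_rpow (by positivity) (by exact_mod_cast hDN) (by positivity)
  have h2ω' : (2 : ℝ) ^ ω ≤ C * (N : ℝ) ^ (θ / κ) :=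
    h2ω.trans (hdiv.trans (mul_le_mul_of_nonneg_left hDθ (by linarith)))
  have hκ0 : (κ : ℝ) ≠ 0 := Nat.cast_ne_zero.mpr (by omega)
  calc (κ : ℝ) ^ ω ≤ ((2 : ℝ) ^ κ) ^ ω := pow_le_pow_left₀ (by positivity) hκ2 ω
    _ = ((2 : ℝ) ^ ω) ^ κ := by rw [← pow_mul, ← pow_mul, mul_comm]
    _ ≤ (C * (N : ℝ) ^ (θ / κ)) ^ κ := pow_le_pow_left₀ (by positivity) h2ω' κ
    _ = C ^ κ * (N : ℝ) ^ θ := by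
        rw [mul_pow, ← Real.rpow_natCast ((N : ℝ) ^ (θ / κ)), ← Real.rpow_mul (by positivity)]
        congr 2
        field_simp

/-- `(log x)² ≤ (4/ν²) x^ν` for `x ≥ 1`, `ν > 0` (from `log x ≤ x^{ν/2}/(ν/2)`). [folklore] -/
private theorem log_sq_le {x ν : ℝ} (hx : 1 ≤ x) (hν : 0 < ν) :
    Real.log x ^ 2 ≤ 4 / ν ^ 2 * x ^ ν := by
  have hx0 : 0 ≤ x := zero_le_one.trans hx
  have hlog : 0 ≤ Real.log x := Real.log_nonneg hx
  have h : Real.log x ≤ x ^ (ν / 2) / (ν / 2) := Real.log_le_rpow_div hx0 (half_pos hν)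
  have hsq : Real.log x ^ 2 ≤ (x ^ (ν / 2) / (ν / 2)) ^ 2 := pow_le_pow_left₀ hlog h 2
  have hr : (x ^ (ν / 2)) ^ 2 = x ^ ν := by
    rw [← Real.rpow_natCast, ← Real.rpow_mul hx0]
    congr 1
    push_cast
    ring
  calc Real.log x ^ 2 ≤ (x ^ (ν / 2) / (ν / 2)) ^ 2 := hsq
    _ = 4 / ν ^ 2 * x ^ ν := by
        rw [div_pow, hr]
        field_simp
        ring

/-- `(log x)³ ≤ (27/ν³) x^ν` for `x ≥ 1`, `ν > 0` (from `log x ≤ x^{ν/3}/(ν/3)`). [folklore] -/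
private theorem log_cube_le {x ν : ℝ} (hx : 1 ≤ x) (hν : 0 < ν) :
    Real.log x ^ 3 ≤ 27 / ν ^ 3 * x ^ ν := by
  have hx0 : 0 ≤ x := zero_le_one.trans hx
  have hlog : 0 ≤ Real.log x := Real.log_nonneg hx
  have h : Real.log x ≤ x ^ (ν / 3) / (ν / 3) := Real.log_le_rpow_div hx0 (by positivity)
  have hcb : Real.log x ^ 3 ≤ (x ^ (ν / 3) / (ν / 3)) ^ 3 := pow_le_pow_left₀ hlog h 3
  have hr : (x ^ (ν / 3)) ^ 3 = x ^ ν := by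
    rw [← Real.rpow_natCast, ← Real.rpow_mul hx0]
    congr 1
    push_cast
    ring
  calc Real.log x ^ 3 ≤ (x ^ (ν / 3) / (ν / 3)) ^ 3 := hcb
    _ = 27 / ν ^ 3 * x ^ ν := by
        rw [div_pow, hr]
        field_simp
        ring

/-- A power threshold: `K < N^e` for all `N ≥ N₂(K, e)`. [folklore] -/
private theorem exists_nat_rpow_gt {K e : ℝ} (hK : 0 < K) (he : 0 < e) :
    ∃ N₂ : ℕ, ∀ N : ℕ, N₂ ≤ N → K < (N : ℝ) ^ e := by
  refine ⟨⌈K ^ (1 / e)⌉₊ + 1, fun N hN => ?_⟩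
  have hNK : K ^ (1 / e) < N := by
    have h1 : K ^ (1 / e) ≤ ⌈K ^ (1 / e)⌉₊ := Nat.le_ceil _
    have h2 : ((⌈K ^ (1 / e)⌉₊ + 1 : ℕ) : ℝ) ≤ N := by exact_mod_cast hN
    push_cast at h2
    linarith
  calc K = (K ^ (1 / e)) ^ e := by
        rw [← Real.rpow_mul hK.le, one_div_mul_cancel he.ne', Real.rpow_one]
    _ < (N : ℝ) ^ e := Real.rpow_lt_rpow (by positivity) hNK he

/-- First half of the multiplicative chain (Thm. 6.1 (a), Cor. 5.3, Frey's identity):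
`S T ≤ L κ' (δ₁ V)` whenever `a δ T = δ₁ b`, `a ≥ 1`, `b ≤ κ'`, `deg φ ≤ L δ`, `S = deg φ · V`.
[cite: PastenShimura2024, proof of Thm. 16.1 p. 49 ((EqUsingRT)–(EqRTF))] -/
private theorem chain_normSq_mul {T a b δ δ₁ dφ V S κω L : ℝ}
    (hEq : a * δ * T = δ₁ * b) (ha : 1 ≤ a) (hT : 0 ≤ T) (hδ : 0 < δ) (hb : b ≤ κω)
    (hδ₁ : 0 ≤ δ₁) (hsand : dφ ≤ L * δ) (hL : 0 ≤ L) (hS : S = dφ * V) (hV : 0 < V) :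
    S * T ≤ L * κω * (δ₁ * V) := by
  have h1 : δ * T ≤ δ₁ * κω := by
    have h0 : δ * T ≤ a * δ * T := by
      have : 0 ≤ δ * T := mul_nonneg hδ.le hT
      nlinarith
    calc δ * T ≤ a * δ * T := h0
      _ = δ₁ * b := hEq
      _ ≤ δ₁ * κω := mul_le_mul_of_nonneg_left hb hδ₁
  have h2 : dφ * T ≤ L * (δ * T) := by
    have := mul_le_mul_of_nonneg_right hsand hT
    linarith
  calc S * T = V * (dφ * T) := by rw [hS]; ring
    _ ≤ V * (L * (δ₁ * κω)) := by
        apply mul_le_mul_of_nonneg_left _ hV.le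
        exact h2.trans (mul_le_mul_of_nonneg_left h1 hL)
    _ = L * κω * (δ₁ * V) := by ring

/-- Second half (heights, Zagier, Manin constant, Petersson bound): `δ₁ V ≤ 163 · 4π² 𝓜² X`.
[cite: PastenShimura2024, proof of Thm. 16.1 p. 49] -/
private theorem chain_deg_mul_covol {δ₁ V V₀ c ff 𝓜 X : ℝ}
    (hzr : 4 * Real.pi ^ 2 * c ^ 2 * ff = δ₁ * V₀) (hδ₁ : 0 ≤ δ₁) (hVV : V ≤ 163 * V₀)
    (hc : |c| ≤ 𝓜) (hff : 0 ≤ ff) (hffX : ff ≤ X) :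
    δ₁ * V ≤ 163 * (4 * Real.pi ^ 2 * 𝓜 ^ 2) * X := by
  have hc2 : c ^ 2 ≤ 𝓜 ^ 2 := sq_le_sq' (abs_le.mp hc).1 (abs_le.mp hc).2
  have h𝓜 : 0 ≤ 𝓜 := (abs_nonneg c).trans hc
  calc δ₁ * V ≤ δ₁ * (163 * V₀) := mul_le_mul_of_nonneg_left hVV hδ₁
    _ = 163 * (4 * Real.pi ^ 2 * (c ^ 2 * ff)) := by rw [← mul_assoc (4 * Real.pi ^ 2), hzr]; ring
    _ ≤ 163 * (4 * Real.pi ^ 2 * (𝓜 ^ 2 * X)) := by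
        have : c ^ 2 * ff ≤ 𝓜 ^ 2 * X := mul_le_mul hc2 hffX hff (by positivity)
        gcongr
    _ = 163 * (4 * Real.pi ^ 2 * 𝓜 ^ 2) * X := by ring

/-! ### Theorem 16.1 from the engine -/

/-- **Pasten 2024, Theorem 16.1, PROVED from the Shimura-curve engine**: the named fact
`pastenShimura2024_thm_16_1` (arXiv:1705.09251v4 Thm. 16.1 p. 49: `S` finite, `ε > 0`, `E/ℚ`
semi-stable away from `S` of conductor `N ≥ N₀(S, ε)`, `N = DM` admissible ⟹
`∏_{p∣D} v_p(Δ_E) < N^{11/3+ε}`) follows from `nonempty_shimuraParametrizationData`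
(Jacquet–Langlands), `ShimuraParametrizationData.normSq_form_eq_deg_mul_covolume` (Frey's identity),
`PastenShimura2024_thm_6_1_a` (Ribet–Takahashi–Pasten, item (a)),
`exists_optimal_modularParametrizationData` (⟺ the Modularity theorem), `PastenShimura2024_cor_10_2`
(Manin constant), `abs_neronLatticeHeight_sub_le_of_isIsogenous` (Faltings + Mazur–Kenku),
`PastenShimura2024_thm_14_1_fDM` (Thm. 14.1 for `f_{D,M}` with Cor. 5.3) and the Mai–Murty-shaped
Petersson bound `Re (f,f) ≤ C N (log N)³` for newforms of elliptic curves — by the printed proof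
(p. 49), Zagier's identity being a theorem of the tree. [cite: PastenShimura2024, Thm. 16.1 with its proof p. 49] -/
theorem pastenShimura2024_thm_16_1_of_engine
    (hJL : nonempty_shimuraParametrizationData)
    (hFrey : ShimuraParametrizationData.normSq_form_eq_deg_mul_covolume)
    (h61a : PastenShimura2024_thm_6_1_a)
    (hopt : exists_optimal_modularParametrizationData)
    (hManin : PastenShimura2024_cor_10_2)
    (hht : abs_neronLatticeHeight_sub_le_of_isIsogenous)
    (h141 : PastenShimura2024_thm_14_1_fDM)
    (hPet : ∃ C : ℝ, ∀ (N : ℕ) [NeZero N] (W : WeierstrassCurve ℚ) [W.IsElliptic]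
      (f : CuspForm (Gamma0 N) 2), IsNewformOf W f →
        (peterssonProduct (Gamma0 N) 2 f f).re ≤ C * N * Real.log N ^ 3) :
    pastenShimura2024_thm_16_1 := by
  intro S ε hε
  classical
  -- constants, chosen before the curve
  obtain ⟨κ, hκ1, -, h61a⟩ := h61a S
  obtain ⟨𝓜, hManin⟩ := hManin S
  obtain ⟨C, hPet⟩ := hPet
  set Cp : ℝ := max C 1 with hCpdef
  have hCp1 : 1 ≤ Cp := le_max_right _ _
  set ν : ℝ := ε / 8 with hνdef
  have hν : 0 < ν := by positivity
  obtain ⟨N₁, h141⟩ := h141 ν hν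
  have hνκ : 0 < ν / κ := by positivity
  obtain ⟨Cη, hCη1, hCη⟩ := Literature.NumberTheory.Sieve.exists_card_divisors_le_mul_rpow' hνκ
  set 𝓜' : ℝ := max (𝓜 : ℝ) 1 with h𝓜'def
  have h𝓜'1 : 1 ≤ 𝓜' := le_max_right _ _
  set K₀ : ℝ := Cη ^ κ * (81 * (4 / ν ^ 2)) * (4 * Real.pi ^ 2 * 𝓜' ^ 2) *
    (Cp * (27 / ν ^ 3)) * 163 with hK₀def
  have hK₀ : 0 < K₀ := by positivity
  obtain ⟨N₂, hN₂⟩ := exists_nat_rpow_gt hK₀ (half_pos hε)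
  refine ⟨max (max N₁ 3) N₂, fun W _ hSaw hN D M hadm _ => ?_⟩
  -- the curve
  set N := W.conductorNorm ℤ with hNdef
  have hNpos : 0 < N := W.conductorNorm_pos_holds
  haveI : NeZero N := ⟨hNpos.ne'⟩
  have hN₁ : N₁ ≤ N := le_trans (le_trans (le_max_left _ _) (le_max_left _ _)) hN
  have hN3 : 3 ≤ N := le_trans (le_trans (le_max_right _ _) (le_max_left _ _)) hN
  have hN₂' : N₂ ≤ N := le_trans (le_max_right _ _) hN
  have hNR : (0 : ℝ) < N := by exact_mod_cast hNpos
  have hN1R : (1 : ℝ) ≤ N := by exact_mod_cast hNpos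
  have hMpos : 0 < M := hadm.pos_right
  have hDM : (D : ℝ) * M = N := by exact_mod_cast hadm.mul_eq
  set T : ℕ := ∏ p ∈ D.primeFactors, (W.minimalDiscriminantNorm ℤ).factorization p with hTdef
  -- the case `D = 1`: empty product
  by_cases hD1 : D = 1
  · have hT : T = 1 := by rw [hTdef, hD1, Nat.primeFactors_one, Finset.prod_empty]
    rw [hT, Nat.cast_one]
    exact Real.one_lt_rpow (by exact_mod_cast (show 1 < N by omega)) (by positivity)
  have hD : 1 < D := lt_of_le_of_ne hadm.pos_left (Ne.symm hD1)
  have hD0 : D ≠ 0 := by omega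
  have hDN : D ≤ N := Nat.le_of_dvd hNpos hadm.left_dvd
  -- a globally minimal model
  obtain ⟨C₀, hC₀⟩ := WeierstrassCurve.hasGlobalMinimalModel_rat_holds W
  haveI := hC₀
  set Wm := C₀ • W with hWm
  have hNeq : Wm.conductorNorm ℤ = N := WeierstrassCurve.conductorNorm_smul_rat W C₀
  have hΔeq : Wm.minimalDiscriminantNorm ℤ = W.minimalDiscriminantNorm ℤ :=
    WeierstrassCurve.minimalDiscriminantNorm_smul_rat W C₀
  -- the data
  obtain ⟨X⟩ := nonempty_shimuraCurveData_holds hadm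
  obtain ⟨PW⟩ := hJL hadm X Wm hNeq
  obtain ⟨W₀', hW₀', P₀, hP₀⟩ := ShimuraParametrizationData.exists_isMinimalFor_of_nonempty ⟨PW⟩
  obtain ⟨W₀, hW₀e, hW₀m, D₀, hnew, hiso, hD₀min⟩ := hopt N Wm hNeq
  obtain ⟨WA, hWAe, hWAm, Pφ, hisoA, hsand, hnormA⟩ := h141 hadm hD hN₁ X Wm hNeq
  -- Thm 6.1 (a)
  obtain ⟨a, b, ha, hb, hbκ, hEq⟩ := h61a hadm X Wm hNeq hSaw W₀ D₀ hnew hD₀min W₀' P₀ hP₀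
  rw [hΔeq] at hEq
  have hbκ' : (b : ℝ) ≤ (κ : ℝ) ^ D.primeFactors.card * D := by exact_mod_cast hbκ
  have hTeq : (a : ℝ) * P₀.deg * T = D₀.deg * b := by
    have : ((D₀.modularDegree * b : ℕ) : ℝ) = ((a * P₀.deg * T : ℕ) : ℝ) := by exact_mod_cast hEq
    push_cast at this
    have hmd : (D₀.modularDegree : ℝ) = D₀.deg := rfl
    rw [hmd] at this
    linarith
  -- Cor 5.3's sandwich against `δ_{D,M} = P₀.deg`
  have hsand' : (Pφ.deg : ℝ) ≤ (9 * Real.log N) ^ 2 * P₀.deg := hsand W₀' P₀ hP₀.1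
  -- Frey's identity for `Pφ`
  have hnorm : X.normSq Pφ.form = Pφ.deg * ZLattice.covolume Pφ.L.lattice := hFrey Pφ
  -- Zagier for the optimal datum
  have hz := D₀.zagier_degree_formula_holds
  have hff0 : 0 < (peterssonProduct (Gamma0 N) 2 D₀.f D₀.f).re := hz.peterssonProduct_re_pos
  have hzr : 4 * Real.pi ^ 2 * (D₀.c : ℝ) ^ 2 * (peterssonProduct (Gamma0 N) 2 D₀.f D₀.f).re =
      D₀.deg * ZLattice.covolume D₀.L.lattice := by
    have := congrArg Complex.re hz
    rwa [Complex.re_ofReal_mul, Complex.ofReal_re] at this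
  -- the Manin constant (Cor 10.2 at `S`)
  have hc : |D₀.maninConstant| ≤ (𝓜 : ℤ) := hManin N W₀ D₀ hSaw hD₀min
  have hc' : |(D₀.c : ℝ)| ≤ 𝓜' := by
    have h1 : ((|D₀.c| : ℤ) : ℝ) ≤ (𝓜 : ℝ) := by exact_mod_cast hc
    rw [Int.cast_abs] at h1
    exact h1.trans (le_max_left _ _)
  -- the Petersson bound (Mai–Murty shape), in power form
  have hpet : (peterssonProduct (Gamma0 N) 2 D₀.f D₀.f).re ≤ Cp * (27 / ν ^ 3) * (N : ℝ) ^ (1 + ν) := by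
    have h1 := hPet N W₀ D₀.f D₀.isNewformOf
    have hlog3 : Real.log N ^ 3 ≤ 27 / ν ^ 3 * (N : ℝ) ^ ν := log_cube_le hN1R hν
    have hNl : 0 ≤ (N : ℝ) * Real.log N ^ 3 := by
      have : 0 ≤ Real.log (N : ℝ) := Real.log_nonneg hN1R
      positivity
    have h2 : C * N * Real.log N ^ 3 ≤ Cp * N * Real.log N ^ 3 := by
      have := le_max_left C 1
      nlinarith
    have h3 : (N : ℝ) * Real.log N ^ 3 ≤ (27 / ν ^ 3) * (N : ℝ) ^ (1 + ν) := by
      calc (N : ℝ) * Real.log N ^ 3 ≤ (N : ℝ) * (27 / ν ^ 3 * (N : ℝ) ^ ν) :=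
            mul_le_mul_of_nonneg_left hlog3 hNR.le
        _ = (27 / ν ^ 3) * ((N : ℝ) ^ (1 : ℝ) * (N : ℝ) ^ ν) := by rw [Real.rpow_one]; ring
        _ = (27 / ν ^ 3) * (N : ℝ) ^ (1 + ν) := by rw [← Real.rpow_add hNR]
    calc (peterssonProduct (Gamma0 N) 2 D₀.f D₀.f).re ≤ C * N * Real.log N ^ 3 := h1
      _ ≤ Cp * N * Real.log N ^ 3 := h2
      _ = Cp * (N * Real.log N ^ 3) := by ring
      _ ≤ Cp * ((27 / ν ^ 3) * (N : ℝ) ^ (1 + ν)) :=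
          mul_le_mul_of_nonneg_left h3 (by linarith)
      _ = Cp * (27 / ν ^ 3) * (N : ℝ) ^ (1 + ν) := by ring
  -- heights: `covol Λ ≤ 163 covol Λ₀`
  have hisoA0 : WA.IsIsogenous W₀ := (hisoA.symm_of_isElliptic).trans' hiso
  have hheight := hht WA W₀ Pφ.L D₀.L Pφ.isNeronLattice D₀.isNeronLattice hisoA0
  have hV : 0 < ZLattice.covolume Pφ.L.lattice := ZLattice.covolume_pos _ _
  have hV₀ : 0 < ZLattice.covolume D₀.L.lattice := ZLattice.covolume_pos _ _
  have hVV : ZLattice.covolume Pφ.L.lattice ≤ 163 * ZLattice.covolume D₀.L.lattice := by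
    unfold neronLatticeHeight at hheight
    have h := (abs_le.mp hheight).1
    have hlog : Real.log (ZLattice.covolume Pφ.L.lattice) ≤
        Real.log (ZLattice.covolume D₀.L.lattice) + Real.log 163 := by linarith
    calc ZLattice.covolume Pφ.L.lattice
        = Real.exp (Real.log (ZLattice.covolume Pφ.L.lattice)) := (Real.exp_log hV).symm
      _ ≤ Real.exp (Real.log (ZLattice.covolume D₀.L.lattice) + Real.log 163) :=
          Real.exp_le_exp.mpr hlog
      _ = 163 * ZLattice.covolume D₀.L.lattice := by
          rw [Real.exp_add, Real.exp_log hV₀, Real.exp_log (by norm_num), mul_comm]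
  -- the two halves of the chain
  set Sn : ℝ := X.normSq Pφ.form with hSdef
  have hST : Sn * T ≤ (9 * Real.log N) ^ 2 * ((κ : ℝ) ^ D.primeFactors.card * D) *
      ((D₀.deg : ℝ) * ZLattice.covolume Pφ.L.lattice) :=
    chain_normSq_mul hTeq (by exact_mod_cast ha) (by positivity) (by exact_mod_cast P₀.deg_pos)
      hbκ' (by positivity) hsand' (by positivity) hnorm hV
  have hδV : (D₀.deg : ℝ) * ZLattice.covolume Pφ.L.lattice ≤
      163 * (4 * Real.pi ^ 2 * 𝓜' ^ 2) * (Cp * (27 / ν ^ 3) * (N : ℝ) ^ (1 + ν)) :=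
    chain_deg_mul_covol hzr (by positivity) hVV hc' hff0.le hpet
  -- `log² N` and `κ^ω` in power form
  have hlogsq : (9 * Real.log N) ^ 2 ≤ 81 * (4 / ν ^ 2 * (N : ℝ) ^ ν) := by
    have h := log_sq_le hN1R hν
    calc (9 * Real.log N) ^ 2 = 81 * Real.log N ^ 2 := by ring
      _ ≤ 81 * (4 / ν ^ 2 * (N : ℝ) ^ ν) := mul_le_mul_of_nonneg_left h (by norm_num)
  have hκω : (κ : ℝ) ^ D.primeFactors.card ≤ Cη ^ κ * (N : ℝ) ^ ν :=
    kappa_pow_le hκ1 hD0 hDN hCη1 hν (hCη D)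
  have hκωD : (κ : ℝ) ^ D.primeFactors.card * D ≤ Cη ^ κ * (N : ℝ) ^ ν * D :=
    mul_le_mul_of_nonneg_right hκω (by positivity)
  -- Thm 14.1: `1 ≤ N^{5/3+ν} M Sn`
  have hS1 : 1 ≤ (N : ℝ) ^ (5 / 3 + ν) * M * Sn := by
    have h := mul_le_mul_of_nonneg_left hnormA
      (show (0 : ℝ) ≤ (N : ℝ) ^ (5 / 3 + ν) * M by positivity)
    have h1 : (N : ℝ) ^ (5 / 3 + ν) * M * ((N : ℝ) ^ (-(5 / 3 + ν)) * (M : ℝ)⁻¹) = 1 := by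
      rw [Real.rpow_neg hNR.le]
      have hM0 : (M : ℝ) ≠ 0 := by exact_mod_cast hMpos.ne'
      field_simp
    calc (1 : ℝ) = (N : ℝ) ^ (5 / 3 + ν) * M * ((N : ℝ) ^ (-(5 / 3 + ν)) * (M : ℝ)⁻¹) := h1.symm
      _ ≤ (N : ℝ) ^ (5 / 3 + ν) * M * Sn := h
  -- assembling
  have hT0 : (0 : ℝ) ≤ T := by positivity
  have hSTb : Sn * T ≤ (81 * (4 / ν ^ 2 * (N : ℝ) ^ ν)) * (Cη ^ κ * (N : ℝ) ^ ν * D) *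
      (163 * (4 * Real.pi ^ 2 * 𝓜' ^ 2) * (Cp * (27 / ν ^ 3) * (N : ℝ) ^ (1 + ν))) := by
    have h0 : 0 ≤ (D₀.deg : ℝ) * ZLattice.covolume Pφ.L.lattice := by positivity
    calc Sn * T ≤ (9 * Real.log N) ^ 2 * ((κ : ℝ) ^ D.primeFactors.card * D) *
          ((D₀.deg : ℝ) * ZLattice.covolume Pφ.L.lattice) := hST
      _ ≤ (81 * (4 / ν ^ 2 * (N : ℝ) ^ ν)) * (Cη ^ κ * (N : ℝ) ^ ν * D) *
          (163 * (4 * Real.pi ^ 2 * 𝓜' ^ 2) * (Cp * (27 / ν ^ 3) * (N : ℝ) ^ (1 + ν))) := by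
          gcongr
  have hpow : (N : ℝ) ^ (5 / 3 + ν) * ((N : ℝ) ^ ν * (N : ℝ) ^ ν * (N : ℝ) ^ (1 + ν)) * N =
      (N : ℝ) ^ ((11 : ℝ) / 3 + ε / 2) := by
    rw [← Real.rpow_add hNR, ← Real.rpow_add hNR, ← Real.rpow_add hNR, ← Real.rpow_add_one hNR.ne']
    congr 1
    rw [hνdef]
    ring
  have hTle : (T : ℝ) ≤ K₀ * (N : ℝ) ^ ((11 : ℝ) / 3 + ε / 2) := by
    calc (T : ℝ) = 1 * T := (one_mul _).symm
      _ ≤ ((N : ℝ) ^ (5 / 3 + ν) * M * Sn) * T := mul_le_mul_of_nonneg_right hS1 hT0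
      _ = (N : ℝ) ^ (5 / 3 + ν) * M * (Sn * T) := by ring
      _ ≤ (N : ℝ) ^ (5 / 3 + ν) * M * ((81 * (4 / ν ^ 2 * (N : ℝ) ^ ν)) *
          (Cη ^ κ * (N : ℝ) ^ ν * D) *
          (163 * (4 * Real.pi ^ 2 * 𝓜' ^ 2) * (Cp * (27 / ν ^ 3) * (N : ℝ) ^ (1 + ν)))) :=
          mul_le_mul_of_nonneg_left hSTb (by positivity)
      _ = K₀ * ((N : ℝ) ^ (5 / 3 + ν) * ((N : ℝ) ^ ν * (N : ℝ) ^ ν * (N : ℝ) ^ (1 + ν)) *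
          ((D : ℝ) * M)) := by
          rw [hK₀def]; ring
      _ = K₀ * (N : ℝ) ^ ((11 : ℝ) / 3 + ε / 2) := by rw [hDM, hpow]
  have hK₀N : K₀ < (N : ℝ) ^ (ε / 2) := hN₂ N hN₂'
  have hfin : K₀ * (N : ℝ) ^ ((11 : ℝ) / 3 + ε / 2) < (N : ℝ) ^ ((11 : ℝ) / 3 + ε) := by
    have hpos : 0 < (N : ℝ) ^ ((11 : ℝ) / 3 + ε / 2) := by positivity
    have hsplit : (N : ℝ) ^ ((11 : ℝ) / 3 + ε) =
        (N : ℝ) ^ (ε / 2) * (N : ℝ) ^ ((11 : ℝ) / 3 + ε / 2) := by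
      rw [← Real.rpow_add hNR]; congr 1; ring
    rw [hsplit]
    exact mul_lt_mul_of_pos_right hK₀N hpos
  exact hTle.trans_lt hfin

/-- **Theorem 16.1 over the engine with the Petersson input BY NAME** (the fact
`murty_petersson_newform_upper_bound` of `ShimuraCurveRibetTakahashi.lean`, through the tree's
`peterssonProduct_re_le_log_pow_three_of_murty`; see that fact's caveat on the exponent of `log N` —
the cube, which suffices here, is what Mai–Murty print). [cite: PastenShimura2024, Thm. 16.1 with its proof p. 49] -/
theorem pastenShimura2024_thm_16_1_of_engine_of_murty
    (hJL : nonempty_shimuraParametrizationData)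
    (hFrey : ShimuraParametrizationData.normSq_form_eq_deg_mul_covolume)
    (h61a : PastenShimura2024_thm_6_1_a)
    (hopt : exists_optimal_modularParametrizationData)
    (hManin : PastenShimura2024_cor_10_2)
    (hht : abs_neronLatticeHeight_sub_le_of_isIsogenous)
    (h141 : PastenShimura2024_thm_14_1_fDM)
    (hMu : murty_petersson_newform_upper_bound) :
    pastenShimura2024_thm_16_1 :=
  pastenShimura2024_thm_16_1_of_engine hJL hFrey h61a hopt hManin hht h141
    (peterssonProduct_re_le_log_pow_three_of_murty hMu)

/-! ### The consumers, by name -/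

/-- **Corollary 16.2** (`pasten_cor_16_2`: `∏_{p ∣ N_E^*} v_p(Δ_E) < N_E^{11/2+ε}` for `E` semi-stable
away from `S` with two multiplicative primes, `N_E ≫ 1`) over the engine — the printed
`(n−1)`-st-root device (`pasten_cor_16_2_of_pastenShimura2024_thm_16_1`) on Thm. 16.1.
[cite: PastenShimura2024, Cor. 16.2 with its proof p. 49] -/
theorem pasten_cor_16_2_of_engine
    (hJL : nonempty_shimuraParametrizationData)
    (hFrey : ShimuraParametrizationData.normSq_form_eq_deg_mul_covolume)
    (h61a : PastenShimura2024_thm_6_1_a)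
    (hopt : exists_optimal_modularParametrizationData)
    (hManin : PastenShimura2024_cor_10_2)
    (hht : abs_neronLatticeHeight_sub_le_of_isIsogenous)
    (h141 : PastenShimura2024_thm_14_1_fDM)
    (hPet : ∃ C : ℝ, ∀ (N : ℕ) [NeZero N] (W : WeierstrassCurve ℚ) [W.IsElliptic]
      (f : CuspForm (Gamma0 N) 2), IsNewformOf W f →
        (peterssonProduct (Gamma0 N) 2 f f).re ≤ C * N * Real.log N ^ 3) :
    Literature.NumberTheory.EllipticCurves.pasten_cor_16_2 :=
  pasten_cor_16_2_of_pastenShimura2024_thm_16_1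
    (pastenShimura2024_thm_16_1_of_engine hJL hFrey h61a hopt hManin hht h141 hPet)

/-- **Theorem 1.15** (`pasten_thm_1_15`: `Tam(E) < K_{S,ε} N_E^{11/2+ε}`) over the engine
(`pasten_thm_1_15_of_pastenShimura2024_thm_16_1` on Thm. 16.1).
[cite: PastenShimura2024, Thm. 1.15 and Cor. 16.3 p. 50] -/
theorem pasten_thm_1_15_of_engine
    (hJL : nonempty_shimuraParametrizationData)
    (hFrey : ShimuraParametrizationData.normSq_form_eq_deg_mul_covolume)
    (h61a : PastenShimura2024_thm_6_1_a)
    (hopt : exists_optimal_modularParametrizationData)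
    (hManin : PastenShimura2024_cor_10_2)
    (hht : abs_neronLatticeHeight_sub_le_of_isIsogenous)
    (h141 : PastenShimura2024_thm_14_1_fDM)
    (hPet : ∃ C : ℝ, ∀ (N : ℕ) [NeZero N] (W : WeierstrassCurve ℚ) [W.IsElliptic]
      (f : CuspForm (Gamma0 N) 2), IsNewformOf W f →
        (peterssonProduct (Gamma0 N) 2 f f).re ≤ C * N * Real.log N ^ 3) :
    Literature.NumberTheory.EllipticCurves.pasten_thm_1_15 :=
  pasten_thm_1_15_of_pastenShimura2024_thm_16_1
    (pastenShimura2024_thm_16_1_of_engine hJL hFrey h61a hopt hManin hht h141 hPet)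

/-- **Theorem 1.12** (`pasten_valuationProduct_semistable`:
`∏_{p ∣ N_E} v_p(Δ_E) < K_ε N_E^{11/2+ε}` for every semi-stable `E/ℚ` — the unconditional rung under
the cruxes of route `RibetTakahashiSplit`) over the engine and Mestre–Oesterlé
(`mestreOesterle_factorization_le_five`, `v_p(Δ_E) ≤ 5` at prime conductor): the printed proof of
Thm. 16.5, first part (`pasten_valuationProduct_semistable_of_cor_16_2`) on Cor. 16.2.
[cite: PastenShimura2024, Thm. 1.12 = Thm. 16.5 first display, with its proof p. 50] -/
theorem pasten_valuationProduct_semistable_of_engine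
    (hJL : nonempty_shimuraParametrizationData)
    (hFrey : ShimuraParametrizationData.normSq_form_eq_deg_mul_covolume)
    (h61a : PastenShimura2024_thm_6_1_a)
    (hopt : exists_optimal_modularParametrizationData)
    (hManin : PastenShimura2024_cor_10_2)
    (hht : abs_neronLatticeHeight_sub_le_of_isIsogenous)
    (h141 : PastenShimura2024_thm_14_1_fDM)
    (hPet : ∃ C : ℝ, ∀ (N : ℕ) [NeZero N] (W : WeierstrassCurve ℚ) [W.IsElliptic]
      (f : CuspForm (Gamma0 N) 2), IsNewformOf W f →
        (peterssonProduct (Gamma0 N) 2 f f).re ≤ C * N * Real.log N ^ 3)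
    (h₂ : Literature.NumberTheory.EllipticCurves.mestreOesterle_factorization_le_five) :
    pasten_valuationProduct_semistable :=
  Literature.NumberTheory.EllipticCurves.pasten_valuationProduct_semistable_of_cor_16_2
    (pasten_cor_16_2_of_engine hJL hFrey h61a hopt hManin hht h141 hPet) h₂

/-- **Theorems 1.12 / 16.5, both displays, in the corrected (strict, `K`-form) shape of
`PastenValuationProductStrict`** over the engine with BOTH items of Thm. 6.1 ((a) for 16.1, (b)
for 16.4) and Mestre–Oesterlé: `pasten_thm_1_12_strict_of_pastenShimura2024_thm_16_1_16_4` on the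
two engine theorems. [cite: PastenShimura2024, Thms. 1.12, 16.1, 16.4, 16.5 (pp. 8, 49–50)] -/
theorem pasten_thm_1_12_strict_of_engine
    (hJL : nonempty_shimuraParametrizationData)
    (hFrey : ShimuraParametrizationData.normSq_form_eq_deg_mul_covolume)
    (h61a : PastenShimura2024_thm_6_1_a) (h61 : PastenShimura2024_thm_6_1_b)
    (hopt : exists_optimal_modularParametrizationData)
    (hManin : PastenShimura2024_cor_10_2)
    (hht : abs_neronLatticeHeight_sub_le_of_isIsogenous)
    (h141 : PastenShimura2024_thm_14_1_fDM)
    (hPet : ∃ C : ℝ, ∀ (N : ℕ) [NeZero N] (W : WeierstrassCurve ℚ) [W.IsElliptic]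
      (f : CuspForm (Gamma0 N) 2), IsNewformOf W f →
        (peterssonProduct (Gamma0 N) 2 f f).re ≤ C * N * Real.log N ^ 3)
    (h₂ : Literature.NumberTheory.EllipticCurves.mestreOesterle_factorization_le_five) :
    ∀ ε : ℝ, 0 < ε → ∃ K : ℝ, 0 < K ∧
      (∀ (W : WeierstrassCurve ℚ) [W.IsElliptic], W.IsSemistable ℤ →
        ((∏ p ∈ (W.conductorNorm ℤ).primeFactors,
            (W.minimalDiscriminantNorm ℤ).factorization p : ℕ) : ℝ)
          < K * (W.conductorNorm ℤ : ℝ) ^ (11 / 2 + ε : ℝ)) ∧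
      (∀ (W : WeierstrassCurve ℚ) [W.IsElliptic], W.IsSemistable ℤ →
        (3 : ℝ) + 11 / ε < ((W.conductorNorm ℤ).primeFactors.card : ℝ) →
          ((∏ p ∈ (W.conductorNorm ℤ).primeFactors,
              (W.minimalDiscriminantNorm ℤ).factorization p : ℕ) : ℝ)
            < K * (W.conductorNorm ℤ : ℝ) ^ (8 / 3 + ε : ℝ)) :=
  pasten_thm_1_12_strict_of_pastenShimura2024_thm_16_1_16_4
    (pastenShimura2024_thm_16_1_of_engine hJL hFrey h61a hopt hManin hht h141 hPet) h₂
    (pastenShimura2024_thm_16_4_of_engine hJL hFrey h61 hopt hManin hht h141)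

end Literature.NumberTheory.DiophantineGeometry

end
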